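import Literature.MathematicalPhysics.QuantumLattice.WeightedOpenClusterUniformWeightsPeriodic
import HarnessLib

/-!
# The `Cu₃O₄` RING WINDOW of the decorated `CuO₂` lattice: every interacting shape of the three-band interaction has an even translate
# inside it — a TURNKEY Emery cluster floor `q₀/(4M) ≤ emeryEnergyDensity θ ρ` from ONE `4⁷`-dimensional cluster certificate

Topic `Literature/MathematicalPhysics/QuantumLattice` (family `hubbard`; crew hubbard-fast S2 (iv) «three-band Emery boxes»).
`WeightedOpenClusterUniformWeightsPeriodic.le_emeryEnergyDensity_of_posSemidef_uniform` turns a cluster certificate on a window `B` into a floor on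
the typed three-band density PROVIDED every interacting shape of `emeryInteraction θ` rooted at a cell point has a superlattice (`(2ℤ)²`)
translate inside `B` (`hfit`). This file discharges `hfit` once and for all for the smallest useful window, the 7-site ring
`W = {(0,0),(1,0),(2,0),(0,1),(2,1),(0,2),(1,2)}` (3 Cu, 2 O_x, 2 O_y; no dummy site; Fock dimension `4⁷ = 16384`):

* §1 `emeryRingWindow` and its coordinate description;
* §2 **the interacting shapes of the three-band interaction** (`exists_shape_of_emeryInteraction_apply_ne_zero`): if `(emeryInteraction θ).Φ X ≠ 0`
  then `X` is a Cu / O_x / O_y site, a Cu–O bond `{x, x+e₁}` (`x` on Cu or O_x), `{x, x+e₂}` (`x` on Cu or O_y), or an O_x–O_y bond `{x, x+ppVec k}`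
  (`x` on O_x) — from `linearFamily_apply` and the atoms' shape / coset lemmas;
* §3 **`emeryRingWindow_fit`**: each such shape has an EVEN translate inside `W` (explicit witnesses), for every `θ`;
* §4 **`le_emeryEnergyDensity_of_ringCertificate`**: for `M > 0`, any `G ∈ 𝔄_W` killed by `2×2`-periodic states and a certificate
  `H^{w}_W[emeryInteraction θ] + G − q₀·1 ⪰ 0` with the uniform `(2ℤ)²`-weight of mass `M`: `q₀/(4M) ≤ emeryEnergyDensity θ ρ` (nonempty class) —
  no side condition left but the certificate.

Definition with body: `emeryRingWindow`; everything else PROVED; no named fact, no number.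

## Mathlib / tree search

REUSED: `emeryInteraction`, `emeryAtoms`, `le_emeryEnergyDensity_of_posSemidef_uniform` (`EmeryThreeBandClusterFloor`, `WeightedOpenClusterUniformWeightsPeriodic`);
`FermionInteraction.linearFamily_apply`; `sublatticeVectorHopping_apply_eq_zero / _apply_pair`, `sublatticeOnSite_apply_eq_zero / _apply_singleton`,
`InCoset`, `liebPeriods`, `cuSite/oxSite/oySite`, `ppVec`, `uvec_ne_zero`, `ppVec_ne_zero`; `shiftSet_pair_eq`, `shiftSet_singleton_eq`, `mem_halfOpenBox`;
Mathlib `Finset.exists_ne_zero_of_sum_ne_zero`. `lean search 'emeryRing|ringWindow'` (2026-08-28): nothing.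

## References

* R. Valentí, J. Stolze, P. J. Hirschfeld, Phys. Rev. B 43 (1991) 13743, §II. [cite: ValentiStolzeHirschfeld1991, §II]
* E. Pavarini et al., Phys. Rev. Lett. 87 (2001) 047003, eq. (1). [cite: PavariniEtAl2001, eq. (1)]
* H. Araki, H. Moriya, Rev. Math. Phys. 15 (2003) 93, §4.1. [cite: ArakiMoriya2003, §4.1 Def. 4.5]
-/

noncomputable section

open scoped ComplexOrder BigOperators
open Finset

namespace Literature.MathematicalPhysics.QuantumLattice

open Matrix HubbardWave0 Literature.Probability.LatticeModels ThermodynamicLimit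
open scoped Matrix.Norms.L2Operator

/-! ### §1 The ring window -/

/-- **The `Cu₃O₄` ring window** `{(0,0),(1,0),(2,0),(0,1),(2,1),(0,2),(1,2)} = [0,3)² ∖ {(1,1),(2,2)}` (Cu at `(0,0),(2,0),(0,2)`, O_x at
`(1,0),(1,2)`, O_y at `(0,1),(2,1)`). [cite: ValentiStolzeHirschfeld1991, §II] -/
def emeryRingWindow : Finset (Site 2) :=
  (halfOpenBox 2 3).filter fun x => ¬ (x 0 = 1 ∧ x 1 = 1) ∧ ¬ (x 0 = 2 ∧ x 1 = 2)

/-- Coordinates of the ring window. [cite: ValentiStolzeHirschfeld1991, §II] -/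
theorem mem_emeryRingWindow_iff {x : Site 2} :
    x ∈ emeryRingWindow ↔ (∀ i, 0 ≤ x i ∧ x i < 3) ∧ ¬ (x 0 = 1 ∧ x 1 = 1) ∧ ¬ (x 0 = 2 ∧ x 1 = 2) := by
  rw [emeryRingWindow, Finset.mem_filter, mem_halfOpenBox]
  norm_num

/-- Membership by the two coordinates. [cite: ValentiStolzeHirschfeld1991, §II] -/
theorem mem_emeryRingWindow_of_coords {x : Site 2} {a b : ℤ} (h0 : x 0 = a) (h1 : x 1 = b)
    (h : ((0 ≤ a ∧ a < 3) ∧ (0 ≤ b ∧ b < 3)) ∧ ¬ (a = 1 ∧ b = 1) ∧ ¬ (a = 2 ∧ b = 2)) : x ∈ emeryRingWindow := by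
  rw [mem_emeryRingWindow_iff, Fin.forall_fin_two, h0, h1]
  exact h

/-! ### §2 The interacting shapes of the three-band interaction -/

/-- Shape and coset of a non-vanishing sublattice hopping term. [cite: PavariniEtAl2001, eq. (1)] -/
theorem exists_pair_of_sublatticeVectorHopping_apply_ne_zero {d : ℕ} (q : Fin d → ℕ) (c : Site d) {v : Site d} (hv : v ≠ 0) (t : ℝ)
    {X : Finset (Site d)} (h : (sublatticeVectorHopping q c v t).Φ X ≠ 0) : ∃ x : Site d, X = {x, x + v} ∧ InCoset q c x := by
  by_cases hX : ∃ x : Site d, X = {x, x + v}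
  · obtain ⟨x, rfl⟩ := hX
    by_cases hc : InCoset q c x
    · exact ⟨x, rfl, hc⟩
    · exact absurd (by rw [sublatticeVectorHopping_apply_pair q c hv t x, if_neg hc]) h
  · exact absurd (sublatticeVectorHopping_apply_eq_zero q c v t fun x hx => hX ⟨x, hx⟩) h

/-- Shape and coset of a non-vanishing sublattice on-site term. [cite: arXiv9311033, §2 (the Hubbard Hamiltonian)] -/
theorem exists_singleton_of_sublatticeOnSite_apply_ne_zero {d : ℕ} (q : Fin d → ℕ) (c : Site d) (ε U : ℝ) {X : Finset (Site d)}
    (h : (sublatticeOnSite q c ε U).Φ X ≠ 0) : ∃ x : Site d, X = {x} ∧ InCoset q c x := by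
  by_cases hX : ∃ x : Site d, X = {x}
  · obtain ⟨x, rfl⟩ := hX
    by_cases hc : InCoset q c x
    · exact ⟨x, rfl, hc⟩
    · exact absurd (by rw [sublatticeOnSite_apply_singleton, if_neg hc]) h
  · exact absurd (sublatticeOnSite_apply_eq_zero q c ε U fun x hx => hX ⟨x, hx⟩) h

/-- **THE INTERACTING SHAPES OF THE THREE-BAND INTERACTION**: if `(emeryInteraction θ).Φ X ≠ 0` then `X` is a Cu–O `e₁`-bond from a Cu or an
O_x site, a Cu–O `e₂`-bond from a Cu or an O_y site, an O_x–O_y bond `{x, x + ppVec k}` from an O_x site, or a Cu / O_x / O_y site.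
[cite: PavariniEtAl2001, eq. (1)] -/
theorem exists_shape_of_emeryInteraction_apply_ne_zero (θ : Fin 14 → ℝ) {X : Finset (Site 2)} (h : (emeryInteraction θ).Φ X ≠ 0) :
    (∃ x, X = {x, x + unitVec 0} ∧ (InCoset liebPeriods cuSite x ∨ InCoset liebPeriods oxSite x)) ∨
    (∃ x, X = {x, x + unitVec 1} ∧ (InCoset liebPeriods cuSite x ∨ InCoset liebPeriods oySite x)) ∨
    (∃ x k, X = {x, x + ppVec k} ∧ InCoset liebPeriods oxSite x) ∨
    (∃ x, X = {x} ∧ (InCoset liebPeriods cuSite x ∨ InCoset liebPeriods oxSite x ∨ InCoset liebPeriods oySite x)) := by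
  rw [emeryInteraction, FermionInteraction.linearFamily_apply, hubbardFermionInteraction_zero_zero_apply, zero_add] at h
  obtain ⟨a, -, ha⟩ := Finset.exists_ne_zero_of_sum_ne_zero h
  have ha' : (emeryAtoms a).Φ X ≠ 0 := fun h0 => ha (by rw [h0, smul_zero])
  fin_cases a
  · obtain ⟨x, hx, hc⟩ := exists_pair_of_sublatticeVectorHopping_apply_ne_zero _ _ (uvec_ne_zero 0) _ ha'
    exact Or.inl ⟨x, hx, Or.inl hc⟩
  · obtain ⟨x, hx, hc⟩ := exists_pair_of_sublatticeVectorHopping_apply_ne_zero _ _ (uvec_ne_zero 0) _ ha'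
    exact Or.inl ⟨x, hx, Or.inr hc⟩
  · obtain ⟨x, hx, hc⟩ := exists_pair_of_sublatticeVectorHopping_apply_ne_zero _ _ (uvec_ne_zero 1) _ ha'
    exact Or.inr (Or.inl ⟨x, hx, Or.inl hc⟩)
  · obtain ⟨x, hx, hc⟩ := exists_pair_of_sublatticeVectorHopping_apply_ne_zero _ _ (uvec_ne_zero 1) _ ha'
    exact Or.inr (Or.inl ⟨x, hx, Or.inr hc⟩)
  · obtain ⟨x, hx, hc⟩ := exists_pair_of_sublatticeVectorHopping_apply_ne_zero _ _ (ppVec_ne_zero 0) _ ha'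
    exact Or.inr (Or.inr (Or.inl ⟨x, 0, hx, hc⟩))
  · obtain ⟨x, hx, hc⟩ := exists_pair_of_sublatticeVectorHopping_apply_ne_zero _ _ (ppVec_ne_zero 1) _ ha'
    exact Or.inr (Or.inr (Or.inl ⟨x, 1, hx, hc⟩))
  · obtain ⟨x, hx, hc⟩ := exists_pair_of_sublatticeVectorHopping_apply_ne_zero _ _ (ppVec_ne_zero 2) _ ha'
    exact Or.inr (Or.inr (Or.inl ⟨x, 2, hx, hc⟩))
  · obtain ⟨x, hx, hc⟩ := exists_pair_of_sublatticeVectorHopping_apply_ne_zero _ _ (ppVec_ne_zero 3) _ ha'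
    exact Or.inr (Or.inr (Or.inl ⟨x, 3, hx, hc⟩))
  · obtain ⟨x, hx, hc⟩ := exists_singleton_of_sublatticeOnSite_apply_ne_zero _ _ _ _ ha'
    exact Or.inr (Or.inr (Or.inr ⟨x, hx, Or.inl hc⟩))
  · obtain ⟨x, hx, hc⟩ := exists_singleton_of_sublatticeOnSite_apply_ne_zero _ _ _ _ ha'
    exact Or.inr (Or.inr (Or.inr ⟨x, hx, Or.inr (Or.inl hc)⟩))
  · obtain ⟨x, hx, hc⟩ := exists_singleton_of_sublatticeOnSite_apply_ne_zero _ _ _ _ ha'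
    exact Or.inr (Or.inr (Or.inr ⟨x, hx, Or.inr (Or.inr hc)⟩))
  · obtain ⟨x, hx, hc⟩ := exists_singleton_of_sublatticeOnSite_apply_ne_zero _ _ _ _ ha'
    exact Or.inr (Or.inr (Or.inr ⟨x, hx, Or.inl hc⟩))
  · obtain ⟨x, hx, hc⟩ := exists_singleton_of_sublatticeOnSite_apply_ne_zero _ _ _ _ ha'
    exact Or.inr (Or.inr (Or.inr ⟨x, hx, Or.inr (Or.inl hc)⟩))
  · obtain ⟨x, hx, hc⟩ := exists_singleton_of_sublatticeOnSite_apply_ne_zero _ _ _ _ ha'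
    exact Or.inr (Or.inr (Or.inr ⟨x, hx, Or.inr (Or.inr hc)⟩))

/-! ### §3 Every interacting shape has an even translate inside the ring -/

/-- A translate by `s − x` of a shape rooted at `x` is even when `x` lies in the coset of `s₀` and `s ≡ s₀ (mod 2)`; packaged for the witnesses
below: from `InCoset (2,2) s₀ x` and the parities of `s − s₀`, `s − x ∈ (2ℤ)²`. [cite: ArakiMoriya2003, §4.1] -/
private theorem inCoset_zero_sub_of_inCoset {s₀ s x : Site 2} (hx : InCoset liebPeriods s₀ x) (h0 : (s 0 - s₀ 0) % 2 = 0)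
    (h1 : (s 1 - s₀ 1) % 2 = 0) : InCoset liebPeriods 0 (s - x) := by
  intro i
  have hxi := hx i
  have hq : ((liebPeriods i : ℕ) : ℤ) + 1 = 2 := by fin_cases i <;> simp [liebPeriods]
  rw [hq] at hxi ⊢
  fin_cases i
  · simp only [Pi.sub_apply, Pi.zero_apply, sub_zero] at hxi ⊢
    simp only [Fin.zero_eta] at hxi ⊢
    omega
  · simp only [Pi.sub_apply, Pi.zero_apply, sub_zero] at hxi ⊢
    simp only [Fin.mk_one] at hxi ⊢
    omega

/-- Translating a pair by `s − x`: `{x, x+u} + (s − x) = {s, s+u}`. [cite: ArakiMoriya2003, §4.1] -/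
private theorem shiftSet_pair_sub (x s u : Site 2) : shiftSet (s - x) ({x, x + u} : Finset (Site 2)) = {s, s + u} := by
  rw [shiftSet_pair_eq, add_sub_cancel, show x + u + (s - x) = s + u by abel]

/-- Translating a singleton by `s − x`: `{x} + (s − x) = {s}`. [cite: ArakiMoriya2003, §4.1] -/
private theorem shiftSet_singleton_sub (x s : Site 2) : shiftSet (s - x) ({x} : Finset (Site 2)) = {s} := by
  rw [shiftSet_singleton_eq, add_sub_cancel]

/-- A pair of ring sites is inside the ring. [cite: ValentiStolzeHirschfeld1991, §II] -/
private theorem pair_subset_ring {s u : Site 2} (hs : s ∈ emeryRingWindow) (hsu : s + u ∈ emeryRingWindow) :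
    ({s, s + u} : Finset (Site 2)) ⊆ emeryRingWindow :=
  Finset.insert_subset hs (Finset.singleton_subset_iff.2 hsu)

/-- **`hfit` FOR THE RING**: every interacting shape of the three-band interaction (at any `θ`) has an even translate inside the `Cu₃O₄` ring
window — hence so does every shape rooted at a cell point. [cite: ValentiStolzeHirschfeld1991, §II] -/
theorem emeryRingWindow_fit (θ : Fin 14 → ℝ) :
    ∀ (c : Cell liebPeriods) (X : Finset (Site 2)), cellPos c ∈ X → (emeryInteraction θ).Φ X ≠ 0 →
      ∃ v : Site 2, InCoset liebPeriods 0 v ∧ shiftSet v X ⊆ emeryRingWindow := by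
  intro c X _ hX
  have hcu0 : (cuSite : Site 2) 0 = 0 := rfl
  have hcu1 : (cuSite : Site 2) 1 = 0 := rfl
  have hox0 : (oxSite : Site 2) 0 = 1 := by simp [oxSite, unitVec]
  have hox1 : (oxSite : Site 2) 1 = 0 := by simp [oxSite, unitVec]
  have hoy0 : (oySite : Site 2) 0 = 0 := by simp [oySite, unitVec]
  have hoy1 : (oySite : Site 2) 1 = 1 := by simp [oySite, unitVec]
  rcases exists_shape_of_emeryInteraction_apply_ne_zero θ hX with ⟨x, rfl, hc⟩ | ⟨x, rfl, hc⟩ | ⟨x, k, rfl, hc⟩ | ⟨x, rfl, hc⟩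
  · -- `e₁` bonds: from Cu put at `(0,0)`, from O_x put at `(1,0)`
    rcases hc with hc | hc
    · refine ⟨cuSite - x, inCoset_zero_sub_of_inCoset hc (by rw [sub_self]; rfl) (by rw [sub_self]; rfl), ?_⟩
      rw [shiftSet_pair_sub]
      exact pair_subset_ring (mem_emeryRingWindow_of_coords hcu0 hcu1 (by norm_num))
        (mem_emeryRingWindow_of_coords (a := 1) (b := 0) (by simp [cuSite, unitVec]) (by simp [cuSite, unitVec]) (by norm_num))
    · refine ⟨oxSite - x, inCoset_zero_sub_of_inCoset hc (by rw [sub_self]; rfl) (by rw [sub_self]; rfl), ?_⟩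
      rw [shiftSet_pair_sub]
      exact pair_subset_ring (mem_emeryRingWindow_of_coords hox0 hox1 (by norm_num))
        (mem_emeryRingWindow_of_coords (a := 2) (b := 0) (by simp [oxSite, unitVec]) (by simp [oxSite, unitVec]) (by norm_num))
  · -- `e₂` bonds: from Cu put at `(0,0)`, from O_y put at `(0,1)`
    rcases hc with hc | hc
    · refine ⟨cuSite - x, inCoset_zero_sub_of_inCoset hc (by rw [sub_self]; rfl) (by rw [sub_self]; rfl), ?_⟩
      rw [shiftSet_pair_sub]
      exact pair_subset_ring (mem_emeryRingWindow_of_coords hcu0 hcu1 (by norm_num))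
        (mem_emeryRingWindow_of_coords (a := 0) (b := 1) (by simp [cuSite, unitVec]) (by simp [cuSite, unitVec]) (by norm_num))
    · refine ⟨oySite - x, inCoset_zero_sub_of_inCoset hc (by rw [sub_self]; rfl) (by rw [sub_self]; rfl), ?_⟩
      rw [shiftSet_pair_sub]
      exact pair_subset_ring (mem_emeryRingWindow_of_coords hoy0 hoy1 (by norm_num))
        (mem_emeryRingWindow_of_coords (a := 0) (b := 2) (by simp [oySite, unitVec]) (by simp [oySite, unitVec]) (by norm_num))
  · -- O_x–O_y bonds: `(1,1)`, `(−1,1)` from `(1,0)`; `(1,−1)`, `(−1,−1)` from `(1,2)`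
    fin_cases k
    · refine ⟨oxSite - x, inCoset_zero_sub_of_inCoset hc (by rw [sub_self]; rfl) (by rw [sub_self]; rfl), ?_⟩
      rw [shiftSet_pair_sub]
      exact pair_subset_ring (mem_emeryRingWindow_of_coords hox0 hox1 (by norm_num))
        (mem_emeryRingWindow_of_coords (a := 2) (b := 1) (by simp [oxSite, unitVec, ppVec]) (by simp [oxSite, unitVec, ppVec]) (by norm_num))
    · refine ⟨oxSite - x, inCoset_zero_sub_of_inCoset hc (by rw [sub_self]; rfl) (by rw [sub_self]; rfl), ?_⟩
      rw [shiftSet_pair_sub]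
      exact pair_subset_ring (mem_emeryRingWindow_of_coords hox0 hox1 (by norm_num))
        (mem_emeryRingWindow_of_coords (a := 0) (b := 1) (by simp [oxSite, unitVec, ppVec]) (by simp [oxSite, unitVec, ppVec]) (by norm_num))
    · refine ⟨oxSite + 2 • unitVec 1 - x, inCoset_zero_sub_of_inCoset hc (by simp [oxSite, unitVec]) (by simp [oxSite, unitVec]), ?_⟩
      rw [shiftSet_pair_sub]
      exact pair_subset_ring
        (mem_emeryRingWindow_of_coords (a := 1) (b := 2) (by simp [oxSite, unitVec]) (by simp [oxSite, unitVec]) (by norm_num))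
        (mem_emeryRingWindow_of_coords (a := 2) (b := 1) (by simp [oxSite, unitVec, ppVec]) (by simp [oxSite, unitVec, ppVec]) (by norm_num))
    · refine ⟨oxSite + 2 • unitVec 1 - x, inCoset_zero_sub_of_inCoset hc (by simp [oxSite, unitVec]) (by simp [oxSite, unitVec]), ?_⟩
      rw [shiftSet_pair_sub]
      exact pair_subset_ring
        (mem_emeryRingWindow_of_coords (a := 1) (b := 2) (by simp [oxSite, unitVec]) (by simp [oxSite, unitVec]) (by norm_num))
        (mem_emeryRingWindow_of_coords (a := 0) (b := 1) (by simp [oxSite, unitVec, ppVec]) (by simp [oxSite, unitVec, ppVec]) (by norm_num))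
  · -- sites
    rcases hc with hc | hc | hc
    · refine ⟨cuSite - x, inCoset_zero_sub_of_inCoset hc (by rw [sub_self]; rfl) (by rw [sub_self]; rfl), ?_⟩
      rw [shiftSet_singleton_sub, Finset.singleton_subset_iff]
      exact mem_emeryRingWindow_of_coords hcu0 hcu1 (by norm_num)
    · refine ⟨oxSite - x, inCoset_zero_sub_of_inCoset hc (by rw [sub_self]; rfl) (by rw [sub_self]; rfl), ?_⟩
      rw [shiftSet_singleton_sub, Finset.singleton_subset_iff]
      exact mem_emeryRingWindow_of_coords hox0 hox1 (by norm_num)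
    · refine ⟨oySite - x, inCoset_zero_sub_of_inCoset hc (by rw [sub_self]; rfl) (by rw [sub_self]; rfl), ?_⟩
      rw [shiftSet_singleton_sub, Finset.singleton_subset_iff]
      exact mem_emeryRingWindow_of_coords hoy0 hoy1 (by norm_num)

/-! ### §4 The turnkey ring floor -/

namespace InfVolFermionState

/-- **THE TURNKEY EMERY RING FLOOR.** For `M > 0`, any `G ∈ 𝔄_W` killed by every `2×2`-periodic state, and a cluster certificate
`H^{w}_W[emeryInteraction θ] + G − q₀·1 ⪰ 0` on the `Cu₃O₄` ring window `W` with the uniform `(2ℤ)²`-weight `w` of mass `M`: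
`q₀/(4M) ≤ emeryEnergyDensity θ ρ` for every `ρ` with `emeryStates ρ` nonempty. [cite: Anderson1951, eq. (2)] [cite: ValentiStolzeHirschfeld1991, §II] -/
theorem le_emeryEnergyDensity_of_ringCertificate (θ : Fin 14 → ℝ) {ρ : ℝ} (hS : (emeryStates ρ).Nonempty) {M : ℝ} (hM : 0 < M)
    {G : FermionOp emeryRingWindow} (hG0 : ∀ ω' : InfVolFermionState 2, ω'.IsPeriodic liebPeriods → (ω'.expect emeryRingWindow G).re = 0)
    {q₀ : ℝ}
    (hq : ((⟨fun X => (uniformPeriodicWeight liebPeriods emeryRingWindow M X : ℂ) • (emeryInteraction θ).Φ X⟩ : FermionInteraction 2).localHamiltonian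
      emeryRingWindow + G - (q₀ : ℂ) • (1 : FermionOp emeryRingWindow)).PosSemidef) :
    q₀ / (4 * M) ≤ emeryEnergyDensity θ ρ :=
  le_emeryEnergyDensity_of_posSemidef_uniform θ hS emeryRingWindow hM (emeryRingWindow_fit θ) hG0 hq

end InfVolFermionState

end Literature.MathematicalPhysics.QuantumLattice

end
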